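import Literature.Barriers.Schanuel.LinearSubgroupMethodLimitWaldschmidtProofs
import Literature.NumberTheory.Transcendental.SixExponentialsSeveralVariablesDischargeProofs

/-!
# Discharge of named literature fact(s) by composition

This file only composes reductions and discharges that are already in the tree
(no new definitions, no new named facts): each `theorem X_holds : X` below feeds the
proved hypotheses into an existing reduction theorem.  Net effect: the listed facts
stop being literature debt.
-/

namespace Literature.Barriers.Schanuel

/-- Discharge of `waldschmidt1981_linearSubgroup_matrix` from the proved Waldschmidt 1981
Thm. 2.1 (`Waldschmidt1981.thm_2_1_holds`) via `waldschmidt1981_linearSubgroup_matrix_of_thm_2_1`.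
[cite: Roy1995, §1 Theorem 1.2 (quoting Waldschmidt, Invent. Math. 63 (1981))] -/
theorem waldschmidt1981_linearSubgroup_matrix_holds : waldschmidt1981_linearSubgroup_matrix :=
  waldschmidt1981_linearSubgroup_matrix_of_thm_2_1
    Literature.NumberTheory.Transcendental.Waldschmidt1981.thm_2_1_holds

end Literature.Barriers.Schanuel
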